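import Literature.MathematicalPhysics.QuantumFieldTheory.Balaban1983to89.B1Prop21RegularTorusFam
import Literature.MathematicalPhysics.QuantumFieldTheory.Balaban1983to89.B1Ineq18RegularRegion

/-!
# `Balaban1983to89.B1Claim18RegularTorusFam` — [B4] §1 TYPED (`Claim18Printed ∧ ThmPrintedNN`) FOR THE (Higgs)₂,₃ CARRIER ON Ω = T_ε AT
# EVERY (2.23)-REGULAR VECTOR FIELD: the in-text claim (1.8) «−Δ^{η,N}_{A,Ω} + aP_k(A) ≥ γ₀I» on the family `regTorusFam` (r14's
# `B1Ineq18RegularRegion.coercive_covOpK_of_reg223` read at `Ω = T_ε`, `m² = 0`) joined with the Theorem p. 573 on the same family (p322075)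

statement-level skeleton of published theorems with citation tags; proofs where landed; nothing here is a claim about the Yang–Mills mass gap

CITATION HEADER (lean-in-tree rule).  T. Bałaban, *Regularity and decay of lattice Green's functions*, Commun. Math. Phys. **89** (1983)
571–597 [Balaban1983RegularityDecay] (p. 573 (1.8), Theorem (1.9)–(1.12) p. 573) and T. Bałaban, *(Higgs)₂,₃ quantum fields in a finite volume. I*,
Commun. Math. Phys. **85** (1982) 603–626 [Balaban1982Higgs1] ((2.15) p. 609, (2.20), (2.22), Prop. 2.1 (2.23)–(2.26) pp. 610–611).  Cell
`lit-balaban`, Phase-2 proof seat **p35** gen 11 (unit `lit-balaban-p35`); SKELETON rows **B4.Claim18** (decl of record `B4.Claim18Printed`, owner r01;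
the (Higgs)₂,₃-carrier instance at a regular `A ≠ 0` is r14 g14's `B1Ineq18RegularRegion`, p322399), **B4.Thm@573**, **B1.Prop2.1** (owner r14).
USED BY NAME, never restated: `B4.{EtaSetting, Claim18Printed}`, `B4Ineq111ZeroNestEta.ThmPrintedNN`, r14's
`B1Ineq18RegularRegion.coercive_covOpK_of_reg223` ((1.8) at a (2.23)-regular `A` for every union of `k`-blocks `Ω ⊂ T_ε`, every torus, constant
`min{2, a(1 − L^{−2})/4}`, smallness `d²·c·e_k^β ≤ 1/3`), this seat's `B1Prop21RegularTorusFam.{RegTorusIdx, regTorusFam, thmPrintedNN_regTorusFam,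
prop21NN_regTorusFam, regTorusFam_nonvacuous}` (p322075), `HiggsCovariancePos.siteInner_self_nonneg`.

WHAT IS PRINTED ([B4] p. 573, verbatim).  *«The operator defining the Green's function (1.6) has a strictly positive lower bound. More exactly we
prove that there exists a positive constant γ₀ such that for e sufficiently small and for a regular vector field A  −Δ^{η,N}_{A,Ω} + aP_k(A) ≥ γ₀I. (1.8)
The constant γ₀ is independent of the lattice spacing η, as well as of Ω and of A.»*, followed by *«Theorem (Proposition 2.1 of [1]). For α < 1 there
exist positive constants δ₀, c₀, R₀ independent of A, k, Ω … such that for e sufficiently small and for an arbitrary function f : Ω → R^N, we have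
(1.9) … (1.10) … (1.11) … (1.12)»*.  The cell's typed leaves: `B4.Claim18Printed fam := ∃ γ₀ e₁ > 0, ∀ i, regular → 0 < e ≤ e₁ → lower18 γ₀` and
`ThmPrintedNN fam` (the Theorem with `0 ≤ α < 1`).

WHAT THIS FILE PROVES (kernel-checked, zero `sorry`; theorems only; no `def`, no `def … : Prop` fact).
* §1 `threshold_reg223` — «for e(L^kε) sufficiently small»: for `c ≥ 0`, `β > 0` a threshold `e₁ > 0` with `d²·c·e^β ≤ 1/3` for all `0 < e ≤ e₁`;
  `gamma18_pos` — `0 < min{2, a(1 − L^{−2})/4}` for `a > 0`, `L ≥ 2`.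
* §2 **`lower18_regTorusFam`** — for EVERY member `i` of `regTorusFam d L C a m² ε₀ c β K₀` (every torus with `P.d = d`, `P.L = L ≥ 2`, every level
  `1 ≤ K ≤ K_P` with `L^Kε ≤ ε₀`, every vector field `A`, every coupling `e_K`; NO cube condition, every `K₀`) that is `regular` ((2.23)) with
  `0 < e_K ≤ e₁`: `(fam i).lower18 γ₀`, i.e. `γ₀⟨φ, φ⟩ ≤ (L^Kε)²⟨φ, (−Δ^{ε,N}_A + a_K(L^Kε)^{−2}P_K(A))φ⟩` for every `φ`, with the EXPLICIT
  `γ₀ = min{2, a(1 − L^{−2})/4}` of r14's theorem — **`claim18Printed_regTorusFam`**: `B4.Claim18Printed (regTorusFam d L C a m² ε₀ c β K₀)` for every `K₀`.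
* §3 **`section1_typed_regTorusFam`** — `∃ K₀min, ∀ K₀ ≥ K₀min, Claim18Printed (regTorusFam …) ∧ ThmPrintedNN (regTorusFam …)`: [B4] §1 typed, (1.8) and
  the Theorem (1.9)–(1.12) (ruled non-negative-Hölder reading), for the (Higgs)₂,₃ carrier at every (2.23)-regular `A` on `Ω = Ω₀ = T_ε`
  (`m² > 0` for the Theorem); `section1_typed_regTorusFam_nonvacuous` (both antecedent sets are met by a member, p322075's witness).
HONEST SCOPE.  (i) (1.8) here is r14's kernel theorem read at `Ω = T_ε`, `m² = 0`; this file adds only the threshold bookkeeping and the typed packaging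
on p35's family.  The sibling `B1Claim18RegularTorus` (p322717, this seat) proves (1.8) on the SUB-family with `bigBlocks` by a different route
(`γ₀ = 1/c₀` from the sup bound (1.10) and the spectral theorem); the present file supersedes its scope restriction (every torus, every `K₀`,
explicit `γ₀`).  (ii) `Ω = T_ε` only (the family's `bdist* = 0`, `δG = 0`); general `Ω ⊂ T_ε` for this carrier at `A ≠ 0`: (1.8) is r14's
`B1Ineq18RegularRegion` (regions), the Theorem is open on this carrier (composite contours vs r01's single-staircase `regionPairFam`).  (iii) The
Theorem half keeps its cube-size threshold `K₀ ≥ K₀min` and its `bigBlocks` antecedent (`K₀ ∣ M`, `3K₀ ≤ 2M`); (1.8) needs neither.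
Unit `lit-balaban-p35` gen 11 (literature-prover-lit-balaban-p35-g11-0).
-/

open scoped BigOperators

noncomputable section

namespace Literature.MathematicalPhysics.QuantumFieldTheory.Balaban1983to89.B1Claim18RegularTorusFam

open Literature.MathematicalPhysics.QuantumFieldTheory.Balaban1983to89.HiggsLattice (ChargeData ScalarField siteInner)
open Literature.MathematicalPhysics.QuantumFieldTheory.Balaban1983to89.HiggsCovariance (covOpK)
open Literature.MathematicalPhysics.QuantumFieldTheory.Balaban1983to89.HiggsCovariancePos (siteInner_self_nonneg)
open Literature.MathematicalPhysics.QuantumFieldTheory.Balaban1983to89.B1Ineq18RegularRegion (coercive_covOpK_of_reg223)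
open Literature.MathematicalPhysics.QuantumFieldTheory.Balaban1983to89.B1Prop21RegularTorusFam (RegTorusIdx regTorusFam
  thmPrintedNN_regTorusFam regTorusFam_nonvacuous)
open Literature.MathematicalPhysics.QuantumFieldTheory.Balaban1983to89.B4 (EtaSetting Claim18Printed)
open Literature.MathematicalPhysics.QuantumFieldTheory.Balaban1983to89.B4Ineq111ZeroNestEta (ThmPrintedNN)

variable {N : ℕ}

/-! ## §1 «for e(L^kε) sufficiently small» and the constant -/

/-- **THE THRESHOLD**: for `c ≧ 0`, `β > 0` and the dimension `d` there is `e₁ > 0` with `d²·c·e^β ≦ 1/3` whenever `0 < e ≦ e₁` (the smallness of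
r14's (1.8); `e₁ = (3(d²c + 1))^{−1/β}`). [cite: Balaban1983RegularityDecay, (1.8) p.573 «for e sufficiently small»]
[cite: Balaban1982Higgs1, Prop. 2.1 p.610 «for e(L^kε) sufficiently small»] -/
theorem threshold_reg223 (d : ℕ) {creg β : ℝ} (hcreg : 0 ≤ creg) (hβ : 0 < β) :
    ∃ e₁ : ℝ, 0 < e₁ ∧ ∀ ec : ℝ, 0 < ec → ec ≤ e₁ → (d : ℝ) ^ 2 * creg * ec ^ β ≤ 1 / 3 := by
  set q : ℝ := 1 / (3 * ((d : ℝ) ^ 2 * creg + 1)) with hq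
  have hD : 0 < (d : ℝ) ^ 2 * creg + 1 := by positivity
  have hqpos : 0 < q := by rw [hq]; positivity
  refine ⟨q ^ (1 / β), Real.rpow_pos_of_pos hqpos _, fun ec hec hle => ?_⟩
  have hpow : ec ^ β ≤ q := by
    have h1 : ec ^ β ≤ (q ^ (1 / β)) ^ β := Real.rpow_le_rpow hec.le hle hβ.le
    rwa [← Real.rpow_mul hqpos.le, one_div_mul_cancel hβ.ne', Real.rpow_one] at h1
  calc (d : ℝ) ^ 2 * creg * ec ^ β ≤ (d : ℝ) ^ 2 * creg * q := mul_le_mul_of_nonneg_left hpow (by positivity)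
    _ = ((d : ℝ) ^ 2 * creg) / ((d : ℝ) ^ 2 * creg + 1) * (1 / 3) := by rw [hq]; field_simp
    _ ≤ 1 * (1 / 3) := mul_le_mul_of_nonneg_right ((div_le_one hD).2 (by linarith)) (by norm_num)
    _ = 1 / 3 := one_mul _

/-- **THE CONSTANT** `γ₀ = min{2, a(1 − L^{−2})/4} > 0` (`a > 0`, `L ≧ 2`; r14's `gammaReg_pos` in the family's parameters).
[cite: Balaban1983RegularityDecay, (1.8) p.573] [cite: Balaban1982Higgs1, (2.15) p.609] -/
theorem gamma18_pos {a : ℝ} (ha : 0 < a) {L : ℕ} (hL : 2 ≤ L) : 0 < min 2 (a * (1 - ((L : ℝ) ^ 2)⁻¹) / 4) := by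
  have hL' : (2 : ℝ) ≤ (L : ℝ) := by exact_mod_cast hL
  have h1 : ((L : ℝ) ^ 2)⁻¹ < 1 := inv_lt_one_of_one_lt₀ (by nlinarith)
  exact lt_min (by norm_num) (by nlinarith [mul_pos ha (show (0 : ℝ) < 1 - ((L : ℝ) ^ 2)⁻¹ by linarith)])

/-! ## §2 (1.8) on every member of `regTorusFam`, and `Claim18Printed` -/

/-- **(1.8) FOR EVERY MEMBER OF `regTorusFam`** (every torus, every level, every vector field; no cube condition): if the member is `regular` ((2.23) in
the form `(L^Kε|e|/e_K)|A_ν(x + εe_μ) − A_ν(x)| ≦ c·e_K^{β−1}/L^K`) and `0 < e_K ≦ e₁` (§1), then `(fam i).lower18 γ₀` with `γ₀ = min{2, a(1 − L^{−2})/4}`: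
`γ₀⟨φ, φ⟩ ≦ (L^Kε)²⟨φ, (−Δ^{ε,N}_A + a_K(L^Kε)^{−2}P_K(A))φ⟩` for every `φ : T_ε → ℝ^N` — r14's `coercive_covOpK_of_reg223` at `Ω = T_ε`, `m² = 0`.
[cite: Balaban1983RegularityDecay, (1.8) p.573] [cite: Balaban1982Higgs1, (2.20), (2.22), Prop. 2.1 (2.23) p.610] -/
theorem lower18_regTorusFam (d L : ℕ) (hL : 2 ≤ L) {a : ℝ} (ha : 0 < a) (msq : ℝ) (C : ChargeData N) (ε₀ : ℝ) {creg : ℝ}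
    (hcreg : 0 ≤ creg) {β : ℝ} (hβ : 0 < β) (K₀ : ℕ) :
    ∃ e₁ : ℝ, 0 < e₁ ∧ ∀ i : RegTorusIdx d L ε₀,
      (regTorusFam d L C a msq ε₀ creg β K₀ i).regular → 0 < (regTorusFam d L C a msq ε₀ creg β K₀ i).e →
      (regTorusFam d L C a msq ε₀ creg β K₀ i).e ≤ e₁ →
        (regTorusFam d L C a msq ε₀ creg β K₀ i).lower18 (min 2 (a * (1 - ((L : ℝ) ^ 2)⁻¹) / 4)) := by
  obtain ⟨e₁, he₁, hsm⟩ := threshold_reg223 d hcreg hβ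
  refine ⟨e₁, he₁, fun i hreg hec hle => ?_⟩
  dsimp only [regTorusFam] at hreg hec hle ⊢
  intro φ
  have hPL1 : 1 < i.P.L := by rw [i.hPL]; omega
  have hsmall : (i.P.d : ℝ) ^ 2 * creg * i.ec ^ β ≤ 1 / 3 := by rw [i.hPd]; exact hsm i.ec hec hle
  have h := coercive_covOpK_of_reg223 C ha hPL1 i.hK1 i.hK Finset.univ (fun _ _ _ => by simp) i.A hec
    (fun z _ μ ν => hreg z ν μ) hsmall 0 φ (fun x hx => absurd (Finset.mem_univ x) hx)
  rw [add_zero, i.hPL] at h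
  have hm : 0 < i.P.mesh i.K := i.P.mesh_pos i.K
  have key : min 2 (a * (1 - ((L : ℝ) ^ 2)⁻¹) / 4) * siteInner φ φ
      = i.P.mesh i.K ^ 2 * (min 2 (a * (1 - ((L : ℝ) ^ 2)⁻¹) / 4) * ((i.P.mesh i.K)⁻¹ ^ 2) * siteInner φ φ) := by
    field_simp
  rw [key]
  exact mul_le_mul_of_nonneg_left h (sq_nonneg _)

/-- **THE IN-TEXT CLAIM (1.8), TYPED (`B4.Claim18Printed`), FOR THE (Higgs)₂,₃ CARRIER AT EVERY (2.23)-REGULAR FIELD ON `Ω = T_ε`** — for every `d`,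
`L ≧ 2`, `a > 0`, `m²` (not entering (1.8)), `N`, `(e, q)`, `ε₀`, `c ≧ 0`, `β > 0` and EVERY `K₀`: `Claim18Printed (regTorusFam d L C a m² ε₀ c β K₀)` with the
witnesses `γ₀ = min{2, a(1 − L^{−2})/4}` («independent of the lattice spacing η, as well as of Ω and of A») and `e₁ = (3(d²c + 1))^{−1/β}`.
[cite: Balaban1983RegularityDecay, (1.8) p.573] -/
theorem claim18Printed_regTorusFam (d L : ℕ) (hL : 2 ≤ L) {a : ℝ} (ha : 0 < a) (msq : ℝ) (C : ChargeData N) (ε₀ : ℝ) {creg : ℝ}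
    (hcreg : 0 ≤ creg) {β : ℝ} (hβ : 0 < β) (K₀ : ℕ) :
    Claim18Printed (regTorusFam d L C a msq ε₀ creg β K₀) := by
  obtain ⟨e₁, he₁, h⟩ := lower18_regTorusFam (N := N) d L hL ha msq C ε₀ hcreg hβ K₀
  exact ⟨_, e₁, gamma18_pos ha hL, he₁, h⟩

/-! ## §3 [B4] §1 typed on `regTorusFam` -/

/-- **[B4] §1 TYPED FOR THE (Higgs)₂,₃ CARRIER AT EVERY (2.23)-REGULAR FIELD ON `Ω = Ω₀ = T_ε`**: for `d`, `L ≧ 2`, `a > 0`, `m² > 0`, `N`, `(e, q)`, `ε₀`,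
`c ≧ 0`, `β > 0` there is `K₀min` (the Theorem's «M sufficiently large») such that for every `K₀ ≧ K₀min` BOTH typed leaves hold on
`regTorusFam d L C a m² ε₀ c β K₀`: `Claim18Printed` ((1.8), §2) and `ThmPrintedNN` (the Theorem (1.9)–(1.12) in its ruled reading `0 ≦ α < 1`,
p322075's `thmPrintedNN_regTorusFam`). [cite: Balaban1983RegularityDecay, (1.8) p.573, Theorem (1.9)–(1.12) p.573]
[cite: Balaban1982Higgs1, Prop. 2.1 (2.23)–(2.26) pp.610–611] -/
theorem section1_typed_regTorusFam (d L : ℕ) (hL : 2 ≤ L) {a : ℝ} (ha : 0 < a) {msq : ℝ} (hmsq : 0 < msq) (C : ChargeData N) (ε₀ : ℝ)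
    {creg : ℝ} (hcreg : 0 ≤ creg) {β : ℝ} (hβ : 0 < β) :
    ∃ K₀min : ℕ, ∀ K₀ : ℕ, K₀min ≤ K₀ →
      Claim18Printed (regTorusFam d L C a msq ε₀ creg β K₀) ∧ ThmPrintedNN (regTorusFam d L C a msq ε₀ creg β K₀) := by
  obtain ⟨K₀min, H⟩ := thmPrintedNN_regTorusFam (N := N) d L hL ha hmsq C ε₀ creg β hcreg hβ
  exact ⟨K₀min, fun K₀ hK₀ => ⟨claim18Printed_regTorusFam d L hL ha msq C ε₀ hcreg hβ K₀, H K₀ hK₀⟩⟩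

/-- **Non-vacuity of both antecedent sets at once**: for `d ≧ 1`, `L ≧ 2`, `ε₀ > 0`, `c ≧ 0`, `K₀ ≧ 1` and ANY two thresholds `e₁, e₁′ > 0` (that of (1.8)
and that of the Theorem) a member of the family is `regular`, has `bigBlocks`, and has `0 < e ≦ min(e₁, e₁′)` (p322075's witness `M = 2K₀`, `K = K_P = 1`,
`ε = ε₀/L`, `A = 0`). [cite: Balaban1982Higgs1, Prop. 2.1 p.610, dictionary] -/
theorem section1_typed_regTorusFam_nonvacuous {d L : ℕ} (hd : 1 ≤ d) (hL : 2 ≤ L) (C : ChargeData N) (a msq : ℝ) {ε₀ : ℝ}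
    (hε₀ : 0 < ε₀) {creg : ℝ} (hcreg : 0 ≤ creg) (β : ℝ) {K₀ : ℕ} (hK₀ : 1 ≤ K₀) {e₁ e₁' : ℝ} (he₁ : 0 < e₁) (he₁' : 0 < e₁') :
    ∃ i : RegTorusIdx d L ε₀,
      (regTorusFam d L C a msq ε₀ creg β K₀ i).regular ∧ (regTorusFam d L C a msq ε₀ creg β K₀ i).bigBlocks ∧
      0 < (regTorusFam d L C a msq ε₀ creg β K₀ i).e ∧ (regTorusFam d L C a msq ε₀ creg β K₀ i).e ≤ e₁ ∧
      (regTorusFam d L C a msq ε₀ creg β K₀ i).e ≤ e₁' := by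
  obtain ⟨i, hreg, hbig, hpos, hle⟩ := regTorusFam_nonvacuous hd hL C a msq hε₀ hcreg β hK₀ (lt_min he₁ he₁')
  exact ⟨i, hreg, hbig, hpos, hle.trans (min_le_left _ _), hle.trans (min_le_right _ _)⟩

end Literature.MathematicalPhysics.QuantumFieldTheory.Balaban1983to89.B1Claim18RegularTorusFam

end
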